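import Mathlib
import Summits.AtomisticToContinuum.Crystallization.Theorems.BraggSlacknessRigidityHcpDiffractionRigidityEssentialPeriodicityIrratArith

/-!
# The dual arithmetic lemma for a transcendental ratio (stub `stub_dualArithTransc` of crux
# `HcpDiffractionRigidity`, item `stmt-AtomisticToContinuum-13166`)

Let `t = h²/a²` be transcendental and `N ⊆ ℝ³` a full-rank lattice with bi-integral Gram form
`D⟪u, v⟫ ∈ ℤa² + ℤh²`.  If some `ξ₀ + N*` lies in the Bragg set `Z = {0} ∪ ⋃_{k ∈ L*} {|η| = |k|}`
of the hcp template (`N*` the dual module), then `N` splits arithmetically: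

* `int_quadratic_eq_zero` — `α a⁴ + β a²h² + γ h⁴ = 0` with `α, β, γ ∈ ℤ` forces `α = β = γ = 0`;
* `exists_lattice_basis`, `exists_dual_family`, `gram_mul_dualGram` — a `ℤ`-basis `e` of `N`, its
  dual family `f` (`⟪fᵢ, v⟫ = i`-th coordinate), and `Gram(e) · Gram(f) = 1`;
* `norm_sq_dual`, `inner_dual` — second differences along `N*`: `48a²h² ⟪m, m'⟫ ∈ ℤa² + ℤh²`
  on `N*`;
* `int_matrix_identities` — writing `D·Gram(e) = P a² + Q h²`, `48a²h²·Gram(f) = Y a² + X h²`,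
  transcendence of `t` turns `Gram(e)Gram(f) = 1 = Gram(f)Gram(e)` into `P X + Q Y = 48D`,
  `X Q = 0`, `Y P = 0`;
* `exists_int_mul_inner_of_transcendental` — hence `48D z = b + c` with `D⟪b, N⟫ ⊆ ℤa²`,
  `D⟪c, N⟫ ⊆ ℤh²`, and the per-vector lemmas `inPlane_integral`, `vertical_integral` of the
  incommensurate arithmetic file give `1152 D² ⟪ξ, z⟫ ∈ ℤ` for EVERY `ξ` with `ξ + N* ⊆ Z`.

All `[folklore]`.
-/

noncomputable section

namespace Summit.AtomisticToContinuum.Crystallization.Theorems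

namespace HcpRigidityDualArith

open scoped BigOperators Real RealInnerProductSpace
open Module Polynomial

/-- Transcendence kills quadratic relations: if `h²/a²` is transcendental over `ℚ` (`a ≠ 0`),
a relation `α a⁴ + β a²h² + γ h⁴ = 0` with `α, β, γ ∈ ℤ` is trivial (the rational polynomial
`α + β X + γ X²` vanishes at `h²/a²`). [folklore] -/
theorem int_quadratic_eq_zero {a h : ℝ} (ha : a ≠ 0) (ht : Transcendental ℚ (h ^ 2 / a ^ 2))
    {α β γ : ℤ} (hrel : (α : ℝ) * a ^ 4 + β * (a ^ 2 * h ^ 2) + γ * h ^ 4 = 0) :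
    α = 0 ∧ β = 0 ∧ γ = 0 := by
  set p : ℚ[X] := C (α : ℚ) + C (β : ℚ) * X + C (γ : ℚ) * X ^ 2 with hp
  have hpt : aeval (h ^ 2 / a ^ 2) p = 0 := by
    simp only [hp, map_add, map_mul, aeval_C, aeval_X, map_pow, eq_ratCast, Rat.cast_intCast]
    have ha4 : a ^ 4 ≠ 0 := pow_ne_zero 4 ha
    field_simp
    linear_combination hrel
  have hp0 : p = 0 := (transcendental_iff.1 ht) p hpt
  have h0 := congr_arg (fun q : ℚ[X] => q.coeff 0) hp0
  have h1 := congr_arg (fun q : ℚ[X] => q.coeff 1) hp0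
  have h2 := congr_arg (fun q : ℚ[X] => q.coeff 2) hp0
  simp only [hp, coeff_add, coeff_C_mul, coeff_X_pow, coeff_C, coeff_X, coeff_zero] at h0 h1 h2
  norm_num at h0 h1 h2
  exact ⟨by exact_mod_cast h0, by exact_mod_cast h1, by exact_mod_cast h2⟩

/-- Transcendence of `h²/a²` implies `h² ∉ ℚ a²`. [folklore] -/
theorem not_exists_rat_of_transcendental {a h : ℝ} (ha : a ≠ 0)
    (ht : Transcendental ℚ (h ^ 2 / a ^ 2)) : ¬ ∃ q : ℚ, h ^ 2 = (q : ℝ) * a ^ 2 := by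
  rintro ⟨q, hq⟩
  apply ht
  have : h ^ 2 / a ^ 2 = algebraMap ℚ ℝ q := by
    rw [hq, eq_ratCast, mul_div_assoc, div_self (pow_ne_zero 2 ha), mul_one]
  rw [this]
  exact isAlgebraic_algebraMap q

/-! ## A `ℤ`-basis of a full-rank lattice, as a real basis -/

/-- A discrete `ℤ`-submodule of `ℝ³` spanning `ℝ³` has a `ℤ`-basis which is an `ℝ`-basis of
`ℝ³`: the basis vectors lie in `N` and every vector of `N` has integer coordinates
(Mathlib's `ZLattice` API). [folklore] -/
theorem exists_lattice_basis (N : Submodule ℤ (EuclideanSpace ℝ (Fin 3))) [DiscreteTopology N]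
    (hspan : Submodule.span ℝ (N : Set (EuclideanSpace ℝ (Fin 3))) = ⊤) :
    ∃ (n : ℕ) (B : Basis (Fin n) ℝ (EuclideanSpace ℝ (Fin 3))),
      (∀ i, B i ∈ N) ∧ ∀ z ∈ N, ∀ i, ∃ m : ℤ, B.repr z i = m := by
  -- adapted from Literature.Algebra.EuclideanLattices.LatticePeriodic (`zBasis`, `rBasis`)
  haveI : IsZLattice ℝ N := ⟨hspan⟩
  haveI := ZLattice.module_free ℝ N
  haveI := ZLattice.module_finite ℝ N
  let b := Module.finBasis ℤ N
  refine ⟨_, b.ofZLatticeBasis ℝ N, fun i => ?_, fun z hz i => ?_⟩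
  · rw [Basis.ofZLatticeBasis_apply]; exact (b i).2
  · exact ⟨b.repr ⟨z, hz⟩ i, by rw [← Basis.ofZLatticeBasis_repr_apply]⟩

/-! ## The dual basis and the two Gram matrices -/

variable {ι : Type*}

/-- The dual family of a real basis `B` of `ℝ³`: vectors `f i` with `⟪f i, v⟫ = (B.repr v) i`.
[folklore] -/
theorem exists_dual_family (B : Basis ι ℝ (EuclideanSpace ℝ (Fin 3))) :
    ∃ f : ι → EuclideanSpace ℝ (Fin 3), ∀ i v, ⟪f i, v⟫ = B.repr v i := by
  refine ⟨fun i => (InnerProductSpace.toDual ℝ (EuclideanSpace ℝ (Fin 3))).symm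
    (LinearMap.toContinuousLinearMap (B.coord i)), fun i v => ?_⟩
  rw [InnerProductSpace.toDual_symm_apply]
  rfl

/-- `G · F = 1` for the Gram matrices `G = (⟪Bᵢ, Bⱼ⟫)` and `F = (⟪fᵢ, fⱼ⟫)` of a basis and its
dual family. [folklore] -/
theorem gram_mul_dualGram [Fintype ι] [DecidableEq ι] {B : Basis ι ℝ (EuclideanSpace ℝ (Fin 3))}
    {f : ι → EuclideanSpace ℝ (Fin 3)} (hf : ∀ i v, ⟪f i, v⟫ = B.repr v i) (i k : ι) :
    ∑ j, ⟪B i, B j⟫ * ⟪f j, f k⟫ = if i = k then 1 else 0 := by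
  have hexp : f k = ∑ j, ⟪f j, f k⟫ • B j := by
    conv_lhs => rw [← B.sum_repr (f k)]
    simp only [hf]
  calc ∑ j, ⟪B i, B j⟫ * ⟪f j, f k⟫ = ⟪B i, ∑ j, ⟪f j, f k⟫ • B j⟫ := by
        rw [inner_sum]
        exact Finset.sum_congr rfl fun j _ => by rw [real_inner_smul_right, mul_comm]
    _ = ⟪f k, B i⟫ := by rw [← hexp, real_inner_comm]
    _ = if i = k then 1 else 0 := by rw [hf, B.repr_self, Finsupp.single_apply]

/-- `F · G = 1` as well (both Gram matrices are symmetric). [folklore] -/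
theorem dualGram_mul_gram [Fintype ι] [DecidableEq ι] {B : Basis ι ℝ (EuclideanSpace ℝ (Fin 3))}
    {f : ι → EuclideanSpace ℝ (Fin 3)} (hf : ∀ i v, ⟪f i, v⟫ = B.repr v i) (i k : ι) :
    ∑ j, ⟪f i, f j⟫ * ⟪B j, B k⟫ = if i = k then 1 else 0 := by
  calc ∑ j, ⟪f i, f j⟫ * ⟪B j, B k⟫ = ∑ j, ⟪B k, B j⟫ * ⟪f j, f i⟫ :=
        Finset.sum_congr rfl fun j _ => by
          rw [real_inner_comm (f j) (f i), real_inner_comm (B k) (B j), mul_comm]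
    _ = if k = i then 1 else 0 := gram_mul_dualGram hf k i
    _ = if i = k then 1 else 0 := by
        rcases eq_or_ne i k with rfl | hik
        · simp
        · simp [hik, hik.symm]

/-- Expansion of the inner product in coordinates: if `D ⟪Bᵢ, Bⱼ⟫ = Pᵢⱼ a² + Qᵢⱼ h²`, then
`D ⟪∑ uᵢ Bᵢ, ∑ vⱼ Bⱼ⟫ = a² · uᵀPv + h² · uᵀQv`. [folklore] -/
theorem gram_expand [Fintype ι] {B : Basis ι ℝ (EuclideanSpace ℝ (Fin 3))} {a h : ℝ} {D : ℕ}
    {P Q : Matrix ι ι ℤ} (hPQ : ∀ i j, (D : ℝ) * ⟪B i, B j⟫ = P i j * a ^ 2 + Q i j * h ^ 2)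
    (u v : ι → ℝ) :
    (D : ℝ) * ⟪∑ i, u i • B i, ∑ j, v j • B j⟫ =
      (∑ j, (∑ i, u i * P i j) * v j) * a ^ 2 + (∑ j, (∑ i, u i * Q i j) * v j) * h ^ 2 := by
  simp only [inner_sum, sum_inner, real_inner_smul_left, real_inner_smul_right, Finset.mul_sum,
    Finset.sum_mul, ← Finset.sum_add_distrib]
  refine Finset.sum_congr rfl fun j _ => Finset.sum_congr rfl fun i _ => ?_
  linear_combination (u i * v j) * hPQ i j

/-- The integer form of `gram_expand`: for integer coordinate vectors `u, w`,
`D ⟪∑ uᵢ Bᵢ, ∑ wⱼ Bⱼ⟫ = (uᵀP · w) a² + (uᵀQ · w) h²`. [folklore] -/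
theorem gram_expand_int [Fintype ι] {B : Basis ι ℝ (EuclideanSpace ℝ (Fin 3))} {a h : ℝ} {D : ℕ}
    {P Q : Matrix ι ι ℤ} (hPQ : ∀ i j, (D : ℝ) * ⟪B i, B j⟫ = P i j * a ^ 2 + Q i j * h ^ 2)
    (u w : ι → ℤ) :
    (D : ℝ) * ⟪∑ i, (u i : ℝ) • B i, ∑ j, (w j : ℝ) • B j⟫ =
      ((Matrix.vecMul u P ⬝ᵥ w : ℤ) : ℝ) * a ^ 2 + ((Matrix.vecMul u Q ⬝ᵥ w : ℤ) : ℝ) * h ^ 2 := by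
  rw [gram_expand hPQ]
  simp only [Matrix.vecMul, dotProduct]
  push_cast
  ring

/-- Packaging entrywise bi-integrality `M i j = r a² + s h²` into integer matrices. [folklore] -/
theorem exists_int_matrices {a h : ℝ} {M : ι → ι → ℝ}
    (hM : ∀ i j, ∃ r s : ℤ, M i j = r * a ^ 2 + s * h ^ 2) :
    ∃ R S : Matrix ι ι ℤ, ∀ i j, M i j = R i j * a ^ 2 + S i j * h ^ 2 := by
  choose R S hRS using hM
  exact ⟨Matrix.of R, Matrix.of S, hRS⟩

/-- **Transcendence splits a product of bi-integral matrices.** If `M₁ = R a² + S h²`,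
`M₂ = R' a² + S' h²` entrywise with integer matrices and `M₁ M₂ = c a² h² · 1`, then (comparing the
coefficients of `a⁴`, `a²h²`, `h⁴`, which are `ℚ`-independent since `h²/a²` is transcendental)
`R R' = 0`, `S S' = 0` and `R S' + S R' = c · 1`. [folklore] -/
theorem int_matrix_identities [Fintype ι] [DecidableEq ι] {a h : ℝ} (ha : a ≠ 0)
    (ht : Transcendental ℚ (h ^ 2 / a ^ 2))
    {M₁ M₂ : ι → ι → ℝ} {R S R' S' : Matrix ι ι ℤ} {c : ℤ}
    (h₁ : ∀ i j, M₁ i j = R i j * a ^ 2 + S i j * h ^ 2)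
    (h₂ : ∀ i j, M₂ i j = R' i j * a ^ 2 + S' i j * h ^ 2)
    (hsum : ∀ i k, ∑ j, M₁ i j * M₂ j k = c * (a ^ 2 * h ^ 2) * if i = k then 1 else 0) :
    R * R' = 0 ∧ S * S' = 0 ∧ R * S' + S * R' = c • (1 : Matrix ι ι ℤ) := by
  have hexp : ∀ i k, ∑ j, M₁ i j * M₂ j k = (∑ j, (R i j : ℝ) * R' j k) * a ^ 4 +
      ((∑ j, (R i j : ℝ) * S' j k) + ∑ j, (S i j : ℝ) * R' j k) * (a ^ 2 * h ^ 2) +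
      (∑ j, (S i j : ℝ) * S' j k) * h ^ 4 := by
    intro i k
    simp only [Finset.sum_mul, add_mul, ← Finset.sum_add_distrib]
    exact Finset.sum_congr rfl fun j _ => by rw [h₁ i j, h₂ j k]; ring
  have key : ∀ i k, (((R * R') i k : ℤ) : ℝ) * a ^ 4 +
      (((R * S' + S * R' - c • (1 : Matrix ι ι ℤ)) i k : ℤ) : ℝ) * (a ^ 2 * h ^ 2) +
      (((S * S') i k : ℤ) : ℝ) * h ^ 4 = 0 := by
    intro i k
    have e := hsum i k
    rw [hexp] at e
    simp only [Matrix.add_apply, Matrix.sub_apply, Matrix.mul_apply, Matrix.smul_apply,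
      Matrix.one_apply, smul_eq_mul]
    push_cast
    linear_combination e
  refine ⟨?_, ?_, ?_⟩
  · ext i k
    exact (int_quadratic_eq_zero ha ht (key i k)).1
  · ext i k
    exact (int_quadratic_eq_zero ha ht (key i k)).2.2
  · ext i k
    have e := (int_quadratic_eq_zero ha ht (key i k)).2.1
    rw [Matrix.sub_apply] at e
    exact sub_eq_zero.1 e

/-! ## Arithmetic of the Bragg set along the dual lattice -/

section Bragg

open Literature.MathematicalPhysics.StatisticalMechanics HcpRigidityIrratArith

/-- Squared norms on the Bragg set `{0} ∪ ⋃_{k ∈ L*} {|η| = |k|}` are bi-integral: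
`12 a² h² |η|² = r a² + s h²` with `r, s ∈ ℤ`. [folklore] -/
theorem norm_sq_bragg {a h : ℝ} (ha : a ≠ 0) (hh : h ≠ 0) {η : EuclideanSpace ℝ (Fin 3)}
    (hη : ¬ (η ≠ 0 ∧ ∀ k : EuclideanSpace ℝ (Fin 3),
      (∀ g ∈ (hcpPeriodicConfiguration ha hh).lattice, ∃ n : ℤ, ⟪k, g⟫ = (n : ℝ)) → ‖η‖ ≠ ‖k‖)) :
    ∃ r s : ℤ, 12 * a ^ 2 * h ^ 2 * ‖η‖ ^ 2 = r * a ^ 2 + s * h ^ 2 := by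
  obtain ⟨N, N', -, -, hN⟩ := exists_norm_sq_of_not_admissible ha hh hη
  exact ⟨3 * N', 4 * N, by rw [hN]; push_cast; ring⟩

/-- **Second differences.** If `ξ₀ + m` lies in the Bragg set for every `m` of the dual module
`N* = {m | ⟪m, s⟫ ∈ ℤ ∀ s ∈ N}`, then `24 a² h² |m|² = r a² + s h²` (`r, s ∈ ℤ`) for every
`m ∈ N*` (parallelogram law with `ξ₀ ± m`, `ξ₀`). [folklore] -/
theorem norm_sq_dual {a h : ℝ} (ha : a ≠ 0) (hh : h ≠ 0)
    {N : Submodule ℤ (EuclideanSpace ℝ (Fin 3))} {ξ₀ : EuclideanSpace ℝ (Fin 3)}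
    (hξ₀ : ∀ m : EuclideanSpace ℝ (Fin 3), (∀ s ∈ N, ∃ n : ℤ, ⟪m, s⟫ = (n : ℝ)) →
      ¬ (ξ₀ + m ≠ 0 ∧ ∀ k' : EuclideanSpace ℝ (Fin 3),
        (∀ g ∈ (hcpPeriodicConfiguration ha hh).lattice, ∃ n : ℤ, ⟪k', g⟫ = (n : ℝ)) →
          ‖ξ₀ + m‖ ≠ ‖k'‖))
    {m : EuclideanSpace ℝ (Fin 3)} (hm : ∀ s ∈ N, ∃ n : ℤ, ⟪m, s⟫ = (n : ℝ)) :
    ∃ r s : ℤ, 24 * a ^ 2 * h ^ 2 * ‖m‖ ^ 2 = r * a ^ 2 + s * h ^ 2 := by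
  have hm' : ∀ s ∈ N, ∃ n : ℤ, ⟪-m, s⟫ = (n : ℝ) := fun s hs => by
    obtain ⟨n, hn⟩ := hm s hs
    exact ⟨-n, by rw [inner_neg_left, hn]; push_cast; ring⟩
  have h0 : ∀ s ∈ N, ∃ n : ℤ, ⟪(0 : EuclideanSpace ℝ (Fin 3)), s⟫ = (n : ℝ) := fun s _ =>
    ⟨0, by rw [inner_zero_left]; push_cast; ring⟩
  obtain ⟨r₁, s₁, h₁⟩ := norm_sq_bragg ha hh (hξ₀ m hm)
  obtain ⟨r₂, s₂, h₂⟩ := norm_sq_bragg ha hh (hξ₀ (-m) hm')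
  obtain ⟨r₀, s₀, h₀⟩ := norm_sq_bragg ha hh (hξ₀ 0 h0)
  rw [norm_add_sq_real] at h₁
  rw [← sub_eq_add_neg, norm_sub_sq_real] at h₂
  rw [add_zero] at h₀
  exact ⟨r₁ + r₂ - 2 * r₀, s₁ + s₂ - 2 * s₀, by push_cast; linear_combination h₁ + h₂ - 2 * h₀⟩

/-- **Polarisation.** Under the same hypothesis, `48 a² h² ⟪m, m'⟫ = r a² + s h²` (`r, s ∈ ℤ`)
for all `m, m' ∈ N*`. [folklore] -/
theorem inner_dual {a h : ℝ} (ha : a ≠ 0) (hh : h ≠ 0)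
    {N : Submodule ℤ (EuclideanSpace ℝ (Fin 3))} {ξ₀ : EuclideanSpace ℝ (Fin 3)}
    (hξ₀ : ∀ m : EuclideanSpace ℝ (Fin 3), (∀ s ∈ N, ∃ n : ℤ, ⟪m, s⟫ = (n : ℝ)) →
      ¬ (ξ₀ + m ≠ 0 ∧ ∀ k' : EuclideanSpace ℝ (Fin 3),
        (∀ g ∈ (hcpPeriodicConfiguration ha hh).lattice, ∃ n : ℤ, ⟪k', g⟫ = (n : ℝ)) →
          ‖ξ₀ + m‖ ≠ ‖k'‖))
    {m m' : EuclideanSpace ℝ (Fin 3)} (hm : ∀ s ∈ N, ∃ n : ℤ, ⟪m, s⟫ = (n : ℝ))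
    (hm' : ∀ s ∈ N, ∃ n : ℤ, ⟪m', s⟫ = (n : ℝ)) :
    ∃ r s : ℤ, 48 * a ^ 2 * h ^ 2 * ⟪m, m'⟫ = r * a ^ 2 + s * h ^ 2 := by
  have hmm' : ∀ s ∈ N, ∃ n : ℤ, ⟪m + m', s⟫ = (n : ℝ) := fun s hs => by
    obtain ⟨n, hn⟩ := hm s hs
    obtain ⟨n', hn'⟩ := hm' s hs
    exact ⟨n + n', by rw [inner_add_left, hn, hn']; push_cast; ring⟩
  obtain ⟨r₁, s₁, h₁⟩ := norm_sq_dual ha hh hξ₀ hm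
  obtain ⟨r₂, s₂, h₂⟩ := norm_sq_dual ha hh hξ₀ hm'
  obtain ⟨r₃, s₃, h₃⟩ := norm_sq_dual ha hh hξ₀ hmm'
  rw [norm_add_sq_real] at h₃
  exact ⟨r₃ - r₁ - r₂, s₃ - s₁ - s₂, by push_cast; linear_combination h₃ - h₁ - h₂⟩

end Bragg

/-! ## The dual arithmetic lemma -/

section Main

open Literature.MathematicalPhysics.StatisticalMechanics HcpRigidityIrratArith

/-- **The dual arithmetic lemma (transcendental ratio).** Let `h²/a²` be transcendental and let
`N ⊆ ℝ³` be a full-rank lattice with bi-integral Gram form `D⟪u, v⟫ ∈ ℤa² + ℤh²`. There is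
`k ≥ 1` such that every `ξ` with `ξ + N*` inside the Bragg set `{0} ∪ ⋃_{k' ∈ L*} {|η| = |k'|}`
pairs `(1/k)`-integrally with `N`. (In a `ℤ`-basis `e` of `N` with dual basis `f`:
`D·Gram(e) = P a² + Q h²` and, by second differences along `N* ∋ fᵢ`, `48a²h²·Gram(f) = Y a² + X h²`
with integer matrices; `Gram(e)·Gram(f) = 1` and transcendence give `P X + Q Y = 48D`,
`X Q = 0`, `Y P = 0`, so `48D z = b + c` with `b ⊥_Q`, `c ⊥_P`, to which the in-plane and vertical
integrality lemmas apply: `6D⟪ξ,b⟫, 8D⟪ξ,c⟫ ∈ ℤ`.) [folklore] -/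
theorem exists_int_mul_inner_of_transcendental {a h : ℝ} (ha : a ≠ 0) (hh : h ≠ 0)
    (ht : Transcendental ℚ (h ^ 2 / a ^ 2)) {N : Submodule ℤ (EuclideanSpace ℝ (Fin 3))} {D : ℕ}
    (hD : 0 < D) [DiscreteTopology N]
    (hspan : Submodule.span ℝ (N : Set (EuclideanSpace ℝ (Fin 3))) = ⊤)
    (hGram : ∀ u ∈ N, ∀ v ∈ N, ∃ n₁ n₂ : ℤ,
      (D : ℝ) * ⟪u, v⟫ = (n₁ : ℝ) * a ^ 2 + (n₂ : ℝ) * h ^ 2) :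
    ∃ k : ℕ, 0 < k ∧ ∀ ξ : EuclideanSpace ℝ (Fin 3),
      (∀ m : EuclideanSpace ℝ (Fin 3), (∀ s ∈ N, ∃ n : ℤ, ⟪m, s⟫ = (n : ℝ)) →
        ¬ (ξ + m ≠ 0 ∧ ∀ k' : EuclideanSpace ℝ (Fin 3),
          (∀ g ∈ (hcpPeriodicConfiguration ha hh).lattice, ∃ n : ℤ, ⟪k', g⟫ = (n : ℝ)) →
            ‖ξ + m‖ ≠ ‖k'‖)) →
      ∀ z ∈ N, ∃ n : ℤ, (k : ℝ) * ⟪ξ, z⟫ = (n : ℝ) := by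
  by_cases hK : ∃ ξ₀ : EuclideanSpace ℝ (Fin 3),
      ∀ m : EuclideanSpace ℝ (Fin 3), (∀ s ∈ N, ∃ n : ℤ, ⟪m, s⟫ = (n : ℝ)) →
        ¬ (ξ₀ + m ≠ 0 ∧ ∀ k' : EuclideanSpace ℝ (Fin 3),
          (∀ g ∈ (hcpPeriodicConfiguration ha hh).lattice, ∃ n : ℤ, ⟪k', g⟫ = (n : ℝ)) →
            ‖ξ₀ + m‖ ≠ ‖k'‖)
  swap
  · exact ⟨1, one_pos, fun ξ hξ => absurd ⟨ξ, hξ⟩ hK⟩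
  obtain ⟨ξ₀, hξ₀⟩ := hK
  have hirr := not_exists_rat_of_transcendental (h := h) ha ht
  -- a lattice basis, its dual family, the two Gram pencils
  obtain ⟨n, B, hBN, hBint⟩ := exists_lattice_basis N hspan
  obtain ⟨f, hf⟩ := exists_dual_family B
  obtain ⟨P, Q, hPQ⟩ := exists_int_matrices fun i j => hGram (B i) (hBN i) (B j) (hBN j)
  have hfN : ∀ i, ∀ s ∈ N, ∃ n : ℤ, ⟪f i, s⟫ = (n : ℝ) := fun i s hs => by
    obtain ⟨m, hm⟩ := hBint s hs i
    exact ⟨m, by rw [hf, hm]⟩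
  obtain ⟨Y, X, hYX⟩ := exists_int_matrices fun i j => inner_dual ha hh hξ₀ (hfN i) (hfN j)
  -- the matrix identities `P X + Q Y = 48 D`, `X Q = 0`, `Y P = 0`
  have hGF : ∀ i k, ∑ j, ((D : ℝ) * ⟪B i, B j⟫) * (48 * a ^ 2 * h ^ 2 * ⟪f j, f k⟫) =
      ((48 * D : ℕ) : ℤ) * (a ^ 2 * h ^ 2) * if i = k then 1 else 0 := fun i k => by
    rw [← gram_mul_dualGram hf i k, Finset.mul_sum]
    push_cast
    exact Finset.sum_congr rfl fun j _ => by ring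
  have hFG : ∀ i k, ∑ j, (48 * a ^ 2 * h ^ 2 * ⟪f i, f j⟫) * ((D : ℝ) * ⟪B j, B k⟫) =
      ((48 * D : ℕ) : ℤ) * (a ^ 2 * h ^ 2) * if i = k then 1 else 0 := fun i k => by
    rw [← dualGram_mul_gram hf i k, Finset.mul_sum]
    push_cast
    exact Finset.sum_congr rfl fun j _ => by ring
  obtain ⟨-, -, hPXQY⟩ := int_matrix_identities ha ht hPQ hYX hGF
  obtain ⟨hYP, hXQ, -⟩ := int_matrix_identities ha ht hYX hPQ hFG
  refine ⟨24 * D * (48 * D), by positivity, fun ξ hξ z hz => ?_⟩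
  have ha2 : a ^ 2 ≠ 0 := pow_ne_zero 2 ha
  have hh2 : h ^ 2 ≠ 0 := pow_ne_zero 2 hh
  -- integer coordinates of `z`, and the splitting `48 D z = b + c`
  choose x hx using fun i => hBint z hz i
  set xb : Fin n → ℤ := Matrix.vecMul x (P * X) with hxb
  set xc : Fin n → ℤ := Matrix.vecMul x (Q * Y) with hxc
  set b : EuclideanSpace ℝ (Fin 3) := ∑ i, (xb i : ℝ) • B i with hb
  set c : EuclideanSpace ℝ (Fin 3) := ∑ i, (xc i : ℝ) • B i with hc
  have hbQ : Matrix.vecMul xb Q = 0 := by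
    rw [hxb, Matrix.vecMul_vecMul, Matrix.mul_assoc, hXQ, Matrix.mul_zero, Matrix.vecMul_zero]
  have hcP : Matrix.vecMul xc P = 0 := by
    rw [hxc, Matrix.vecMul_vecMul, Matrix.mul_assoc, hYP, Matrix.mul_zero, Matrix.vecMul_zero]
  have hsum : (48 * (D : ℝ)) • z = b + c := by
    have hxbc : xb + xc = ((48 * D : ℕ) : ℤ) • x := by
      rw [hxb, hxc, ← Matrix.vecMul_add, hPXQY, Matrix.vecMul_smul, Matrix.vecMul_one]
    conv_lhs => rw [← B.sum_repr z]
    rw [Finset.smul_sum, hb, hc, ← Finset.sum_add_distrib]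
    refine Finset.sum_congr rfl fun i _ => ?_
    rw [hx, smul_smul, ← add_smul]
    congr 1
    have e := congr_fun hxbc i
    simp only [Pi.add_apply, Pi.smul_apply, smul_eq_mul] at e
    push_cast at e
    exact_mod_cast e.symm
  have hcoord : ∀ s ∈ N, ∃ xs : Fin n → ℤ, s = ∑ j, (xs j : ℝ) • B j := fun s hs => by
    choose xs hxs using fun i => hBint s hs i
    exact ⟨xs, by conv_lhs => rw [← B.sum_repr s]; simp only [hxs]⟩
  -- in-plane part `b`: `D⟪b, N⟫ ⊆ ℤa²`, so `(D i/a²) b ∈ N*` and `6D⟪ξ, b⟫ ∈ ℤ`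
  have hbs : ∀ s ∈ N, ∃ K : ℤ, (D : ℝ) * ⟪b, s⟫ = K * a ^ 2 := fun s hs => by
    obtain ⟨xs, rfl⟩ := hcoord s hs
    exact ⟨Matrix.vecMul xb P ⬝ᵥ xs, by
      rw [hb, gram_expand_int hPQ, hbQ, zero_dotProduct, Int.cast_zero, zero_mul, add_zero]⟩
  have hnb : (D : ℝ) * ‖b‖ ^ 2 = ((Matrix.vecMul xb P ⬝ᵥ xb : ℤ) : ℝ) * a ^ 2 := by
    rw [← real_inner_self_eq_norm_sq, hb, gram_expand_int hPQ, hbQ, zero_dotProduct, Int.cast_zero,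
      zero_mul, add_zero]
  have hBb := fun i : ℤ => hξ (((D : ℝ) / a ^ 2) • (i : ℝ) • b) fun s hs => by
    obtain ⟨K, hK⟩ := hbs s hs
    refine ⟨i * K, ?_⟩
    rw [real_inner_smul_left, real_inner_smul_left]
    push_cast
    field_simp
    linear_combination (i : ℝ) * hK
  obtain ⟨A, hA⟩ := inPlane_integral ha hh hirr hnb hBb
  -- vertical part `c`: `D⟪c, N⟫ ⊆ ℤh²`, so `(D j/h²) c ∈ N*` and `8D⟪ξ, c⟫ ∈ ℤ`
  have hcs : ∀ s ∈ N, ∃ K : ℤ, (D : ℝ) * ⟪c, s⟫ = K * h ^ 2 := fun s hs => by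
    obtain ⟨xs, rfl⟩ := hcoord s hs
    exact ⟨Matrix.vecMul xc Q ⬝ᵥ xs, by
      rw [hc, gram_expand_int hPQ, hcP, zero_dotProduct, Int.cast_zero, zero_mul, zero_add]⟩
  have hnc : (D : ℝ) * ‖c‖ ^ 2 = ((Matrix.vecMul xc Q ⬝ᵥ xc : ℤ) : ℝ) * h ^ 2 := by
    rw [← real_inner_self_eq_norm_sq, hc, gram_expand_int hPQ, hcP, zero_dotProduct, Int.cast_zero,
      zero_mul, zero_add]
  have hBc := fun j : ℤ => hξ (((D : ℝ) * (j : ℝ) / h ^ 2) • c) fun s hs => by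
    obtain ⟨K, hK⟩ := hcs s hs
    refine ⟨j * K, ?_⟩
    rw [real_inner_smul_left]
    push_cast
    field_simp
    linear_combination (j : ℝ) * hK
  obtain ⟨B', hB'⟩ := vertical_integral ha hh hirr hnc hBc
  -- conclusion: `24 D ⟪ξ, 48 D z⟫ = 4 (6D⟪ξ,b⟫) + 3 (8D⟪ξ,c⟫) ∈ ℤ`
  have e1 : 24 * (D : ℝ) * ⟪ξ, b⟫ = 4 * A := mul_right_cancel₀ hh2 (by linear_combination hA)
  have e2 : 24 * (D : ℝ) * ⟪ξ, c⟫ = 3 * B' := mul_right_cancel₀ ha2 (by linear_combination hB')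
  have hbc : ⟪ξ, b⟫ + ⟪ξ, c⟫ = 48 * D * ⟪ξ, z⟫ := by
    rw [← inner_add_right, ← hsum, real_inner_smul_right]
  refine ⟨4 * A + 3 * B', ?_⟩
  push_cast
  linear_combination e1 + e2 - 24 * (D : ℝ) * hbc

end Main

end HcpRigidityDualArith

/-- **STUB (transcendental route) — the dual arithmetic lemma.** For `h²/a²` transcendental and a
full-rank lattice `N ⊆ ℝ³` with `D⟪u, v⟫ ∈ ℤa² + ℤh²` (`u, v ∈ N`), there is `k ≥ 1` such that
every `ξ` whose translate `ξ + N*` of the dual module lies in the Bragg set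
`{0} ∪ ⋃_{k' ∈ L*} {|η| = |k'|}` of the hcp template satisfies `k⟪ξ, z⟫ ∈ ℤ` for all `z ∈ N`
(`k = 1152 D²` works as soon as one such `ξ` exists). [folklore] -/
theorem stub_dualArithTransc : ∀ (a h : ℝ) (ha : a ≠ 0) (hh : h ≠ 0), Transcendental ℚ (h ^ 2 / a ^ 2) → ∀ (N : Submodule ℤ (EuclideanSpace ℝ (Fin 3))) (D : ℕ), 0 < D → DiscreteTopology N → Submodule.span ℝ (N : Set (EuclideanSpace ℝ (Fin 3))) = ⊤ → (∀ u ∈ N, ∀ v ∈ N, ∃ n₁ n₂ : ℤ, (D : ℝ) * inner ℝ u v = (n₁ : ℝ) * a ^ 2 + (n₂ : ℝ) * h ^ 2) → ∃ k : ℕ, 0 < k ∧ ∀ ξ : EuclideanSpace ℝ (Fin 3), (∀ m : EuclideanSpace ℝ (Fin 3), (∀ s ∈ N, ∃ n : ℤ, inner ℝ m s = (n : ℝ)) → ¬ (ξ + m ≠ 0 ∧ ∀ k' : EuclideanSpace ℝ (Fin 3), (∀ g ∈ (Literature.MathematicalPhysics.StatisticalMechanics.hcpPeriodicConfiguration ha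 hh).lattice, ∃ n : ℤ, inner ℝ k' g = (n : ℝ)) → ‖ξ + m‖ ≠ ‖k'‖)) → ∀ z ∈ N, ∃ n : ℤ, (k : ℝ) * inner ℝ ξ z = (n : ℝ) :=
  fun _ _ ha hh ht _ _ hD _ hspan hGram =>
    HcpRigidityDualArith.exists_int_mul_inner_of_transcendental ha hh ht hD hspan hGram

end Summit.AtomisticToContinuum.Crystallization.Theorems

end
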